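import Mathlib
import Summits.Ventures.PercRepro2.BoxUnionDefs
import Summits.Ventures.PercRepro2.BoxUnionFKG
import Summits.Ventures.PercRepro2.BoxUnion
import Summits.Ventures.PercRepro2.BoxUnionShapeWitness

/-!
# The shape theorem: box unions are exactly the restriction sets that keep the FKG covariance
nonnegative (blind cell PercRepro2, mine-1 g37; part 2 of 2, paper proof
proofs/MINE1-BOXUNION-SHAPE.md)

Call `U ⊆ α` *good* if `∑_{x ∈ U} ν x (f x − E f)(g x − E g) ≥ 0` for every nonnegative
log-supermodular weight `ν` of positive mass and all monotone `f g`.  `BoxUnion.boxUnion_nonneg`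
says that every box union `↓a ∪ ↑b` is good; the single boxes `↓a`, `↑b` and `∅` are good too
(`Iic_good`, `Ici_good`).  This file proves the CONVERSE: a good set is `∅`, `↓a`, `↑b` or
`↓a ∪ ↑b` (`good_imp_boxUnion`, and the equivalence `good_iff`).

The negative witnesses are the four-point weights of `BoxUnionShapeWitness.lean`.  The
combinatorial core: a good `U` has order-convex complement (no chain trace), hence `U = D ∪ V`
with `D` the largest down-set and `V` the largest up-set inside `U`; `D` is closed under `⊔` (a
missing `y ≤ d ⊔ d'` splits as `(y ⊓ d) ⊔ (y ⊓ d')` by distributivity and produces a bad square)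
and `V` under `⊓`, so both are principal (`Finset.sup'_mem` / `Finset.inf'_mem`).
-/

namespace Summit.Ventures.PercRepro2

namespace BoxUnion

open Finset

open scoped Classical

noncomputable section

section Shape

variable {α : Type*} [DistribLattice α] [Fintype α]

/-- **The shape theorem (necessity).** If the restricted covariance on `U` is nonnegative for
every nonnegative log-supermodular weight of positive mass and all monotone `f g`, then `U` is
`∅`, a principal down-set `↓a`, a principal up-set `↑b`, or a box union `↓a ∪ ↑b`. -/
theorem good_imp_boxUnion (U : Set α)
    (hU : ∀ ν f g : α → ℝ, (∀ x, 0 ≤ ν x) → (∀ x y, ν x * ν y ≤ ν (x ⊓ y) * ν (x ⊔ y)) →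
      0 < ∑ x, ν x → Monotone f → Monotone g →
      0 ≤ ∑ x, if x ∈ U then ν x * ((f x - mean ν f) * (g x - mean ν g)) else 0) :
    U = ∅ ∨ (∃ a, U = Set.Iic a) ∨ (∃ b, U = Set.Ici b) ∨ ∃ a b, U = boxUnion a b := by
  -- the three forbidden traces
  have conv : ∀ x y z : α, x < y → y < z → x ∉ U → y ∈ U → z ∉ U → False := by
    intro x y z hxy hyz hx hy hz
    obtain ⟨ν, f, g, h1, h2, h3, h4, h5, h6⟩ := chain_witness hxy hyz hx hy hz
    linarith [hU ν f g h1 h2 h3 h4 h5]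
  have sqtop : ∀ d d' : α, ¬ d ≤ d' → ¬ d' ≤ d → d ⊓ d' ∈ U → d ∈ U → d' ∈ U →
      d ⊔ d' ∉ U → False := by
    intro d d' h1 h2 hm hd hd' hs
    obtain ⟨ν, f, g, k1, k2, k3, k4, k5, k6⟩ := square_top_witness h1 h2 hm hd hd' hs
    linarith [hU ν f g k1 k2 k3 k4 k5]
  have sqbot : ∀ d d' : α, ¬ d ≤ d' → ¬ d' ≤ d → d ⊓ d' ∉ U → d ∈ U → d' ∈ U →
      d ⊔ d' ∈ U → False := by
    intro d d' h1 h2 hm hd hd' hs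
    obtain ⟨ν, f, g, k1, k2, k3, k4, k5, k6⟩ := square_bot_witness h1 h2 hm hd hd' hs
    linarith [hU ν f g k1 k2 k3 k4 k5]
  -- the largest down-set and the largest up-set inside `U`
  set D : Set α := {x | Set.Iic x ⊆ U} with hDdef
  set V : Set α := {x | Set.Ici x ⊆ U} with hVdef
  have hDU : D ⊆ U := fun x hx => hx (Set.mem_Iic.mpr le_rfl)
  have hVU : V ⊆ U := fun x hx => hx (Set.mem_Ici.mpr le_rfl)
  have hDdown : ∀ x ∈ D, ∀ y, y ≤ x → y ∈ D := fun x hx y hyx t ht =>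
    hx (Set.mem_Iic.mpr ((Set.mem_Iic.mp ht).trans hyx))
  have hVup : ∀ x ∈ V, ∀ y, x ≤ y → y ∈ V := fun x hx y hxy t ht =>
    hx (Set.mem_Ici.mpr (hxy.trans (Set.mem_Ici.mp ht)))
  -- `U = D ∪ V` (order-convexity of the complement)
  have hUDV : U = D ∪ V := by
    ext x
    constructor
    · intro hx
      by_contra hcon
      simp only [Set.mem_union, not_or] at hcon
      obtain ⟨y, hyx, hyU⟩ : ∃ y, y ≤ x ∧ y ∉ U := by
        by_contra h
        exact hcon.1 (fun y hy => by_contra fun hyU => h ⟨y, Set.mem_Iic.mp hy, hyU⟩)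
      obtain ⟨z, hxz, hzU⟩ : ∃ z, x ≤ z ∧ z ∉ U := by
        by_contra h
        exact hcon.2 (fun z hz => by_contra fun hzU => h ⟨z, Set.mem_Ici.mp hz, hzU⟩)
      exact conv y x z (lt_of_le_of_ne hyx (fun h => hyU (h ▸ hx)))
        (lt_of_le_of_ne hxz (fun h => hzU (h ▸ hx))) hyU hx hzU
    · rintro (hx | hx)
      · exact hDU hx
      · exact hVU hx
  -- `D` is closed under `⊔`
  have hDsup : ∀ d ∈ D, ∀ d' ∈ D, d ⊔ d' ∈ D := by
    intro d hd d' hd' y hy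
    rw [Set.mem_Iic] at hy
    by_contra hyU
    have h1 : y ⊓ d ∈ D := hDdown d hd _ inf_le_right
    have h2 : y ⊓ d' ∈ D := hDdown d' hd' _ inf_le_right
    have hjoin : (y ⊓ d) ⊔ (y ⊓ d') = y := by
      rw [← inf_sup_left, inf_eq_left.mpr hy]
    have hn1 : ¬ y ⊓ d ≤ y ⊓ d' := fun h =>
      hyU (by rw [← hjoin, sup_eq_right.mpr h]; exact hDU h2)
    have hn2 : ¬ y ⊓ d' ≤ y ⊓ d := fun h =>
      hyU (by rw [← hjoin, sup_eq_left.mpr h]; exact hDU h1)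
    exact sqtop (y ⊓ d) (y ⊓ d') hn1 hn2 (hDU (hDdown _ h1 _ inf_le_left)) (hDU h1) (hDU h2)
      (by rw [hjoin]; exact hyU)
  -- `V` is closed under `⊓`
  have hVinf : ∀ v ∈ V, ∀ v' ∈ V, v ⊓ v' ∈ V := by
    intro v hv v' hv' y hy
    rw [Set.mem_Ici] at hy
    by_contra hyU
    have h1 : y ⊔ v ∈ V := hVup v hv _ le_sup_right
    have h2 : y ⊔ v' ∈ V := hVup v' hv' _ le_sup_right
    have hmeet : (y ⊔ v) ⊓ (y ⊔ v') = y := by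
      rw [← sup_inf_left, sup_eq_left.mpr hy]
    have hn1 : ¬ y ⊔ v ≤ y ⊔ v' := fun h =>
      hyU (by rw [← hmeet, inf_eq_left.mpr h]; exact hVU h1)
    have hn2 : ¬ y ⊔ v' ≤ y ⊔ v := fun h =>
      hyU (by rw [← hmeet, inf_eq_right.mpr h]; exact hVU h2)
    exact sqbot (y ⊔ v) (y ⊔ v') hn1 hn2 (by rw [hmeet]; exact hyU) (hVU h1) (hVU h2)
      (hVU (hVup _ h1 _ le_sup_left))
  -- a nonempty `⊔`-closed down-set is principal
  have hDprin : D = ∅ ∨ ∃ a, D = Set.Iic a := by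
    by_cases hDe : D = ∅
    · exact Or.inl hDe
    · right
      obtain ⟨x₀, hx₀⟩ := Set.nonempty_iff_ne_empty.mpr hDe
      have hne : (Finset.univ.filter (fun x => x ∈ D)).Nonempty := ⟨x₀, by simp [hx₀]⟩
      refine ⟨(Finset.univ.filter (fun x => x ∈ D)).sup' hne id, ?_⟩
      have hmem : (Finset.univ.filter (fun x => x ∈ D)).sup' hne id ∈ D :=
        Finset.sup'_mem D (fun x hx y hy => hDsup x hx y hy) _ hne id
          (fun i hi => (Finset.mem_filter.mp hi).2)
      ext x
      constructor
      · intro hx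
        exact Set.mem_Iic.mpr (Finset.le_sup' id (by simpa using hx))
      · intro hx
        exact hDdown _ hmem x (Set.mem_Iic.mp hx)
  have hVprin : V = ∅ ∨ ∃ b, V = Set.Ici b := by
    by_cases hVe : V = ∅
    · exact Or.inl hVe
    · right
      obtain ⟨x₀, hx₀⟩ := Set.nonempty_iff_ne_empty.mpr hVe
      have hne : (Finset.univ.filter (fun x => x ∈ V)).Nonempty := ⟨x₀, by simp [hx₀]⟩
      refine ⟨(Finset.univ.filter (fun x => x ∈ V)).inf' hne id, ?_⟩
      have hmem : (Finset.univ.filter (fun x => x ∈ V)).inf' hne id ∈ V :=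
        Finset.inf'_mem V (fun x hx y hy => hVinf x hx y hy) _ hne id
          (fun i hi => (Finset.mem_filter.mp hi).2)
      ext x
      constructor
      · intro hx
        exact Set.mem_Ici.mpr (Finset.inf'_le id (by simpa using hx))
      · intro hx
        exact hVup _ hmem x (Set.mem_Ici.mp hx)
  -- conclusion
  rcases hDprin with hD0 | ⟨a, ha⟩ <;> rcases hVprin with hV0 | ⟨b, hb⟩
  · left
    rw [hUDV, hD0, hV0, Set.empty_union]
  · right; right; left
    exact ⟨b, by rw [hUDV, hD0, hb, Set.empty_union]⟩
  · right; left
    exact ⟨a, by rw [hUDV, ha, hV0, Set.union_empty]⟩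
  · right; right; right
    refine ⟨a, b, ?_⟩
    rw [hUDV, ha, hb]
    ext x
    simp only [Set.mem_union, Set.mem_Iic, Set.mem_Ici, mem_boxUnion]

/-- A single down-box `↓a` is good (the shift trick of `boxUnion_nonneg` on
`phiOn_nonneg_down`). -/
theorem Iic_good (a : α) {ν f g : α → ℝ} (hν : ∀ x, 0 ≤ ν x)
    (hlsm : ∀ x y, ν x * ν y ≤ ν (x ⊓ y) * ν (x ⊔ y)) (hZ : 0 < ∑ x, ν x)
    (hf : Monotone f) (hg : Monotone g) :
    0 ≤ ∑ x, if x ∈ Set.Iic a then ν x * ((f x - mean ν f) * (g x - mean ν g)) else 0 := by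
  have key := phiOn_nonneg_down (ν := ν) hν hlsm hZ
    (φ := fun x => f x + ∑ y, |f y|)
    (ψ := fun x => g x + ∑ y, |g y|)
    (fun x => by
      have h1 : |f x| ≤ ∑ y, |f y| := single_le_sum (fun y _ => abs_nonneg (f y)) (mem_univ x)
      linarith [neg_abs_le (f x)])
    (fun x => by
      have h1 : |g x| ≤ ∑ y, |g y| := single_le_sum (fun y _ => abs_nonneg (g y)) (mem_univ x)
      linarith [neg_abs_le (g x)])
    (fun x y _ _ => by linarith [hf (le_sup_left : x ≤ x ⊔ y)])
    (fun x y _ _ => by linarith [hg (le_sup_left : x ≤ x ⊔ y)])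
    (fun x => x ≤ a) (fun x y hx hy => ⟨inf_le_left.trans hx, sup_le hx hy⟩)
    (fun x y hx => inf_le_left.trans hx)
  rw [phiOn_shift hZ] at key
  simpa [phiOn, Set.mem_Iic] using key

/-- A single up-box `↑b` is good. -/
theorem Ici_good (b : α) {ν f g : α → ℝ} (hν : ∀ x, 0 ≤ ν x)
    (hlsm : ∀ x y, ν x * ν y ≤ ν (x ⊓ y) * ν (x ⊔ y)) (hZ : 0 < ∑ x, ν x)
    (hf : Monotone f) (hg : Monotone g) :
    0 ≤ ∑ x, if x ∈ Set.Ici b then ν x * ((f x - mean ν f) * (g x - mean ν g)) else 0 := by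
  have key := phiOn_nonneg_up (ν := ν) hν hlsm hZ
    (φ := fun x => f x + ∑ y, |f y|)
    (ψ := fun x => g x + ∑ y, |g y|)
    (fun x => by
      have h1 : |f x| ≤ ∑ y, |f y| := single_le_sum (fun y _ => abs_nonneg (f y)) (mem_univ x)
      linarith [neg_abs_le (f x)])
    (fun x => by
      have h1 : |g x| ≤ ∑ y, |g y| := single_le_sum (fun y _ => abs_nonneg (g y)) (mem_univ x)
      linarith [neg_abs_le (g x)])
    (fun x y _ _ => by linarith [hf (le_sup_left : x ≤ x ⊔ y)])
    (fun x y _ _ => by linarith [hg (le_sup_left : x ≤ x ⊔ y)])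
    (fun x => b ≤ x) (fun x y hx hy => ⟨le_inf hx hy, hx.trans le_sup_left⟩)
    (fun x y hx => hx.trans le_sup_left)
  rw [phiOn_shift hZ] at key
  simpa [phiOn, Set.mem_Ici] using key

/-- **The shape theorem.** `U` keeps the restricted covariance nonnegative for every nonnegative
log-supermodular weight of positive mass and all monotone `f g` IF AND ONLY IF `U` is `∅`, a
principal down-set, a principal up-set, or a box union `↓a ∪ ↑b`. -/
theorem good_iff (U : Set α) :
    (∀ ν f g : α → ℝ, (∀ x, 0 ≤ ν x) → (∀ x y, ν x * ν y ≤ ν (x ⊓ y) * ν (x ⊔ y)) →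
      0 < ∑ x, ν x → Monotone f → Monotone g →
      0 ≤ ∑ x, if x ∈ U then ν x * ((f x - mean ν f) * (g x - mean ν g)) else 0) ↔
    (U = ∅ ∨ (∃ a, U = Set.Iic a) ∨ (∃ b, U = Set.Ici b) ∨ ∃ a b, U = boxUnion a b) := by
  constructor
  · exact good_imp_boxUnion U
  · rintro (rfl | ⟨a, rfl⟩ | ⟨b, rfl⟩ | ⟨a, b, rfl⟩) ν f g hν hlsm hZ hf hg
    · simp
    · exact Iic_good a hν hlsm hZ hf hg
    · exact Ici_good b hν hlsm hZ hf hg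
    · exact boxUnion_nonneg hν hlsm hZ hf hg

end Shape

end

end BoxUnion

end Summit.Ventures.PercRepro2
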